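import Mathlib
import Summits.ValiantsHypothesis.ValiantsHypothesis.Theorems.GeneratorObstructionsGenFlipThesisSliceTransfer

/-!
# Route GeneratorObstructions — crux `GenFlipThesis` (stmt-ValiantsHypothesis-11653), line
# `slice-overflow`: the CHOW DICHOTOMY made formal

Helper file (`--supports stmt-ValiantsHypothesis-11653`) for the registered line
`Cruxes/GenFlipThesis/Lines/slice_overflow.lean` (stub `stub_sliceGen`) and the crux idea
`Ideas/chow-covariant-generation.md` (strategist, 2026-08-17), whose "first lemma" and "decisive
consequence" were typed but not proved (`Cruxes/GenFlipThesis/SketchChow.lean`).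

The diagonal monomial `w_m = x₁₁ x₂₂ ⋯ x_mm` (a point of the Chow variety `Ch_m` of products of `m`
linear forms, `Ch_m(ℂ^{m²}) = Δ(w_m)`) is a COMMON DEGENERATION of the permanent and of the power
trace:

* `prod_X_diag_mem_orbitClosure_rename_perPoly`: `∏ x_{f i, f i} ∈ Δ(per_m placed along f)` for any
  injective `f : Fin m → Fin n` (kill the off-diagonal variables: `per` of a diagonal matrix,
  `Matrix.permanent_diagonal`; `End · f ⊆ Δ(f)`), in particular in per's own variables
  (`prod_X_diag_mem_orbitClosure_perPoly`) and for the route's block placement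
  (`prod_X_diag_mem_orbitClosure_blockPer`);
* `prod_X_mem_orbitClosure_powFormLex`: ANY product of `m` variables lies in `Δ(tr X_n^m)` for
  `1 ≤ m ≤ n` — it is `tr(C^m)` for the weighted `m`-cycle `C` (`hasPowTraceRepr_prod_X`, the tree's
  `cycMat` gadget), Gesmundo–Ikenmeyer–Panova 2017 Prop. 5.

This is the idea card's `FirstLemmaChowInBoth` (`firstLemmaChowInBoth`).  With the landed
generator-obstruction principle and the slice transfer engine
(`GeneratorObstructionsGenFlipThesisSliceTransfer`) it yields the DICHOTOMY the line card states
informally ("that single computation decides which side of the route survives"):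

* `chowGenQP_of_sliceGen`, `chowGenQP_of_powGenDegreeQP`: `stub_sliceGen` (a fortiori the route's
  K2 = `PowGenDegreeQP`) forces the covariant algebra `A(Δ w_m)` (w_m in its own `m²` letters) to be
  generated in quasi-polynomial degree;
* `perGenDegreeSuperQP_of_chowLate`: late generators of `A(Δ w_m)` (cofinally in `m`, beyond every
  quasi-polynomial degree) PROVE the route's K1 = `PerGenDegreeSuperQP` (stmt-11654);
* `not_sliceGen_of_chowLate`, `not_powGenDegreeQP_of_chowLate`: the same late generators REFUTE
  `stub_sliceGen` and K2 — so the Chow computation can only confirm K1 while killing the trace side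
  of the overflow engine, or be consistent with both (`chowLate_dichotomy`).

Honest framing: all statements here are implications between OPEN statements plus two membership
facts; `stub_sliceGen`, K1, K2, `GenFlipThesis` remain open and `VP ≠ VNP` is not touched.

References: Gesmundo–Ikenmeyer–Panova, Diff. Geom. Appl. 55 (2017) §2.2, Prop. 5; Bürgisser–
Hüttenhain–Ikenmeyer, Proc. AMS 145 (2017) §3 (`Chow_n ⊆ Det_n` by killing off-diagonal
variables — here for `per`); Landsberg, *Geometry and Complexity Theory* (2017) §9 (Chow variety);
Derksen–Makam 2020 Lemma 1.3.
-/

namespace Summit.ValiantsHypothesis.ValiantsHypothesis.Theorems.GeneratorObstructions.ChowDichotomy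

open MvPolynomial
open Literature.NumberTheory.DiophantineGeometry Literature.Computability.AlgebraicComplexity
  Literature.Barriers.ValiantsHypothesis
open Summit.ValiantsHypothesis.ValiantsHypothesis.Theses.GeneratorObstructions
open Summit.ValiantsHypothesis.ValiantsHypothesis.Theorems.GenInheritance
open Summit.ValiantsHypothesis.ValiantsHypothesis.Theorems.GeneratorObstructions.SliceTransfer

-- `Summit.ValiantsHypothesis.ValiantsHypothesis.…` is the tree's mandated single-conjunct layout.
set_option linter.dupNamespace false

noncomputable section

/-! ## 1. The diagonal monomial degenerates from the permanent -/

section PerSide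

/-- An algebra map killing the off-diagonal variables of the generic `m × m` matrix sends `per_m`
to the product of the images of the diagonal variables (`per` of a diagonal matrix,
`Matrix.permanent_diagonal`). [folklore] -/
theorem algHom_perPoly_eq_prod_of_diag {R : Type*} [CommRing R] [Algebra ℂ R] {m : ℕ}
    (ψ : MvPolynomial (Fin m × Fin m) ℂ →ₐ[ℂ] R) (d : Fin m → R)
    (hψ : ∀ i j, ψ (X (i, j)) = if i = j then d i else 0) :
    ψ (perPoly (Fin m) ℂ) = ∏ i, d i := by
  have hmat : ψ.mapMatrix (Matrix.mvPolynomialX (Fin m) (Fin m) ℂ) = Matrix.diagonal d := by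
    refine Matrix.ext fun i j => ?_
    rw [AlgHom.mapMatrix_apply, Matrix.map_apply, Matrix.mvPolynomialX_apply, hψ, Matrix.diagonal_apply]
  have hper : ψ (perPoly (Fin m) ℂ) = (ψ.mapMatrix (Matrix.mvPolynomialX (Fin m) (Fin m) ℂ)).permanent := by
    simp only [perPoly, Matrix.permanent, map_sum, map_prod, AlgHom.mapMatrix_apply, Matrix.map_apply]
  rw [hper, hmat, Matrix.permanent_diagonal]

/-- **`∏ᵢ x_{f i, f i} ∈ Δ(per_m placed along f)`** for an injective `f : Fin m → Fin n`: the linear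
ENDOMORPHISM of the variable space keeping the diagonal letters `x_{aa}` and killing all others
carries the placed permanent to the product of its diagonal variables; `End · f ⊆ Δ(f)`
(`endOrbit_subset_orbitClosure_holds`).  Bürgisser–Hüttenhain–Ikenmeyer 2017 §3 (there for `det`).
[folklore] -/
theorem prod_X_diag_mem_orbitClosure_rename_perPoly {m n : ℕ} (f : Fin m → Fin n)
    (hf : Function.Injective f) :
    (∏ i : Fin m, X (toLex (f i, f i)) : MvPolynomial (MatIdx n) ℂ) ∈
      orbitClosure (rename (fun ij : Fin m × Fin m => (toLex (f ij.1, f ij.2) : MatIdx n))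
        (perPoly (Fin m) ℂ)) := by
  classical
  set D : Matrix (MatIdx n) (MatIdx n) ℂ :=
    Matrix.of fun u w => if u = w ∧ (ofLex w).1 = (ofLex w).2 then 1 else 0 with hD
  refine endOrbit_subset_orbitClosure_holds _ ⟨D, ?_⟩
  have hDX : ∀ w : MatIdx n, linSubst (MatIdx n) ℂ D (X w) =
      if (ofLex w).1 = (ofLex w).2 then X w else 0 := by
    intro w
    rw [linSubst_X, Finset.sum_eq_single w]
    · rw [hD, Matrix.of_apply]
      by_cases h : (ofLex w).1 = (ofLex w).2
      · rw [if_pos ⟨rfl, h⟩, if_pos h, one_smul]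
      · rw [if_neg (fun hh => h hh.2), if_neg h, zero_smul]
    · intro u _ hu
      rw [hD, Matrix.of_apply, if_neg (fun hh => hu hh.1), zero_smul]
    · intro h; exact absurd (Finset.mem_univ w) h
  change linSubst (MatIdx n) ℂ D (rename _ (perPoly (Fin m) ℂ)) = _
  have key := algHom_perPoly_eq_prod_of_diag
    ((linSubst (MatIdx n) ℂ D).comp (rename (fun ij : Fin m × Fin m => (toLex (f ij.1, f ij.2) : MatIdx n))))
    (fun i => (X (toLex (f i, f i)) : MvPolynomial (MatIdx n) ℂ)) (fun i j => by
      rw [AlgHom.comp_apply, rename_X, hDX]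
      simp only [ofLex_toLex, hf.eq_iff]
      split_ifs with h
      · subst h; rfl
      · rfl)
  rw [AlgHom.comp_apply] at key
  exact key

/-- **`x₁₁ ⋯ x_mm ∈ Δ(per_m)`** in per's own `m²` lexicographic letters (`f = id`). [folklore] -/
theorem prod_X_diag_mem_orbitClosure_perPoly (m : ℕ) :
    (∏ i : Fin m, X (toLex (i, i)) : MvPolynomial (MatIdx m) ℂ) ∈
      orbitClosure (rename toLex (perPoly (Fin m) ℂ)) := by
  have h := prod_X_diag_mem_orbitClosure_rename_perPoly (m := m) (n := m) id Function.injective_id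
  have hfun : (fun ij : Fin m × Fin m => (toLex (id ij.1, id ij.2) : MatIdx m)) = toLex := by
    funext ij; rfl
  rw [hfun] at h
  exact h

/-- **`∏ᵢ x_{ii} ∈ Δ(per_m on the top-left block)`** of the `(m+e) × (m+e)` matrix variables (the
route's placement `Fin.castAdd e`); the per half of the idea card's `FirstLemmaChowInBoth`.
[folklore] -/
theorem prod_X_diag_mem_orbitClosure_blockPer (m e : ℕ) :
    (∏ i : Fin m, X (toLex (Fin.castAdd e i, Fin.castAdd e i)) : MvPolynomial (MatIdx (m + e)) ℂ) ∈
      orbitClosure (rename (fun ij : Fin m × Fin m => toLex (Fin.castAdd e ij.1, Fin.castAdd e ij.2))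
        (perPoly (Fin m) ℂ)) :=
  prod_X_diag_mem_orbitClosure_rename_perPoly (Fin.castAdd e) (Fin.castAdd_injective m e)

end PerSide

/-! ## 2. Any product of `m` variables degenerates from the power trace -/

section TraceSide

/-- **A product of `m ≥ 1` variables is a power trace of size `m`**: `∏ᵢ x_{vᵢ} = tr(C^m)` for the
weighted `m`-cycle `C` with weights `x_{v₀}/m, x_{v₁}, …, x_{v_{m-1}}` (`trace_cycMat_pow`:
`tr(C^m) = m · ∏ weights`).  Gesmundo–Ikenmeyer–Panova 2017 §2.2. [folklore] -/
theorem hasPowTraceRepr_prod_X {σ : Type*} {m : ℕ} (hm : 1 ≤ m) (v : Fin m → σ) :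
    HasPowTraceRepr ℂ (∏ i : Fin m, (X (v i) : MvPolynomial σ ℂ)) m m := by
  haveI : NeZero m := ⟨by omega⟩
  set w : Fin m → MvPolynomial σ ℂ := fun i => C (if i = 0 then ((m : ℂ)⁻¹) else 1) * X (v i) with hw
  refine ⟨cycMat w, fun i j => ?_, ?_⟩
  · rw [cycMat, Matrix.of_apply]
    split_ifs
    · exact (isHomogeneous_C _ _).mul (isHomogeneous_X _ _)
    · exact isHomogeneous_zero _ _ _
  · rw [trace_cycMat_pow, hw]
    simp only []
    rw [Finset.prod_mul_distrib, ← map_prod, Finset.prod_ite_eq', if_pos (Finset.mem_univ _),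
      nsmul_eq_mul, ← mul_assoc, ← map_natCast C, ← map_mul,
      mul_inv_cancel₀ (Nat.cast_ne_zero.mpr (NeZero.ne m)), map_one, one_mul]

/-- **`∏ᵢ x_{vᵢ} ∈ Δ(tr X_n^m)`** for `1 ≤ m ≤ n` and any `m` letters `v i` of the `n × n` matrix:
pad the weighted cycle to size `n` (`HasPowTraceRepr.of_le`) and apply GIP17 Prop. 5
(`mem_orbitClosure_powFormLex_of_hasPowTraceRepr`).  In particular the Chow variety
`Ch_m(ℂ^{n²})` lies in `Δ(tr X_n^m)`. [folklore] -/
theorem prod_X_mem_orbitClosure_powFormLex {m n : ℕ} (hm : 1 ≤ m) (hmn : m ≤ n)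
    (v : Fin m → MatIdx n) :
    (∏ i : Fin m, (X (v i) : MvPolynomial (MatIdx n) ℂ)) ∈ orbitClosure (powFormLex ℂ n m) :=
  mem_orbitClosure_powFormLex_of_hasPowTraceRepr
    (HasPowTraceRepr.of_le hm hmn (hasPowTraceRepr_prod_X hm v))

/-- **`FirstLemmaChowInBoth`** (crux idea `chow-covariant-generation`, typed in
`Cruxes/GenFlipThesis/SketchChow.lean`, proved here verbatim): for `1 ≤ m` the block-diagonal
monomial `∏ᵢ x_{ii}` (`i < m`) of the `(m+e) × (m+e)` matrix variables lies in the orbit closure of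
the block permanent AND in that of the power trace `tr X_{m+e}^m`. [folklore] -/
theorem firstLemmaChowInBoth :
    ∀ m e : ℕ, 1 ≤ m →
      (∏ i : Fin m, (X (toLex (Fin.castAdd e i, Fin.castAdd e i)) : MvPolynomial (MatIdx (m + e)) ℂ)) ∈
          orbitClosure (MvPolynomial.rename (fun ij : Fin m × Fin m => toLex (Fin.castAdd e ij.1, Fin.castAdd e ij.2))
            (perPoly (Fin m) ℂ)) ∧
      (∏ i : Fin m, (X (toLex (Fin.castAdd e i, Fin.castAdd e i)) : MvPolynomial (MatIdx (m + e)) ℂ)) ∈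
          orbitClosure (powFormLex ℂ (m + e) m) :=
  fun m e hm => ⟨prod_X_diag_mem_orbitClosure_blockPer m e,
    prod_X_mem_orbitClosure_powFormLex hm (Nat.le_add_right m e) _⟩

/-- A product of `m` distinct-or-not variables is a form of degree `m`. [folklore] -/
theorem prod_X_isHomogeneous {σ : Type*} {m : ℕ} (v : Fin m → σ) :
    (∏ i : Fin m, (X (v i) : MvPolynomial σ ℂ)).IsHomogeneous m := by
  have h := IsHomogeneous.prod Finset.univ (fun i => (X (v i) : MvPolynomial σ ℂ)) (fun _ => 1)
    (fun i _ => isHomogeneous_X ℂ (v i))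
  simpa using h

/-- A product of variables is nonzero (over a field). [folklore] -/
theorem prod_X_ne_zero {σ : Type*} {m : ℕ} (v : Fin m → σ) :
    (∏ i : Fin m, (X (v i) : MvPolynomial σ ℂ)) ≠ 0 :=
  Finset.prod_ne_zero_iff.mpr fun i _ => X_ne_zero (v i)

end TraceSide

/-! ## 3. The dichotomy -/

section Dichotomy

/-- **`stub_sliceGen ⇒ ChowGenQP`.**  If the slice generator types of `A(Δ(tr X_n^m))` have
quasi-polynomial degree throughout the window (the registered `stub_sliceGen`, hypothesis verbatim),
then the covariant algebra of the Chow variety `Ch_m(ℂ^{m²}) = Δ(x₁₁⋯x_mm)` (own `m²` letters) is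
generated in quasi-polynomial degree: every generator type `χ` has `-|χ| ≤ m · 2^((log₂ m + c₀)^c₀)`
whenever `m ≤ 2^((log₂ m + c)^c)` (automatic for `c ≥ 1`).  Transfer engine at `n = m`, `e = 0`:
the monomial placed on the final segment is a product of `m` variables, hence in `Δ(tr X_m^m)`.
[folklore] -/
theorem chowGenQP_of_sliceGen
    (hS : ∀ c : ℕ, ∃ c₀ : ℕ, ∀ m e : ℕ, 1 ≤ m → m + e ≤ 2 ^ ((Nat.log 2 m + c) ^ c) →
      ∀ ι : MatIdx m → MatIdx (m + e), StrictMono ι → IsUpperSet (Set.range ι) →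
        ∀ χ : Weight (MatIdx m),
          Module.finrank ℂ (↥(highestWeightSpace (orbitCoordRep (powFormLex ℂ (m + e) m) m) (Function.extend ι χ 0)) ⧸ Submodule.comap (highestWeightSpace (orbitCoordRep (powFormLex ℂ (m + e) m) m) (Function.extend ι χ 0)).subtype (⨆ p : Weight (MatIdx (m + e)) × Weight (MatIdx (m + e)), ⨆ (_ : p.1 + p.2 = (Function.extend ι χ 0) ∧ p.1 ≠ 0 ∧ p.2 ≠ 0), highestWeightSpace (orbitCoordRep (powFormLex ℂ (m + e) m) m) p.1 * highestWeightSpace (orbitCoordRep (powFormLex ℂ (m + e) m) m) p.2)) ≠ 0 →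
            -(Weight.size χ) ≤ (m : ℤ) * 2 ^ ((Nat.log 2 m + c₀) ^ c₀)) :
    ∀ c : ℕ, ∃ c₀ : ℕ, ∀ m : ℕ, 1 ≤ m → m ≤ 2 ^ ((Nat.log 2 m + c) ^ c) →
      ∀ χ : Weight (MatIdx m),
        Module.finrank ℂ (↥(highestWeightSpace (orbitCoordRep (∏ i : Fin m, (X (toLex (i, i)) : MvPolynomial (MatIdx m) ℂ)) m) χ) ⧸ Submodule.comap (highestWeightSpace (orbitCoordRep (∏ i : Fin m, (X (toLex (i, i)) : MvPolynomial (MatIdx m) ℂ)) m) χ).subtype (⨆ p : Weight (MatIdx m) × Weight (MatIdx m), ⨆ (_ : p.1 + p.2 = χ ∧ p.1 ≠ 0 ∧ p.2 ≠ 0), highestWeightSpace (orbitCoordRep (∏ i : Fin m, (X (toLex (i, i)) : MvPolynomial (MatIdx m) ℂ)) m) p.1 * highestWeightSpace (orbitCoordRep (∏ i : Fin m, (X (toLex (i, i)) : MvPolynomial (MatIdx m) ℂ)) m) p.2)) ≠ 0 →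
          -(Weight.size χ) ≤ (m : ℤ) * 2 ^ ((Nat.log 2 m + c₀) ^ c₀) := by
  intro c
  obtain ⟨c₀, hc₀⟩ := hS c
  refine ⟨c₀, fun m hm hwin χ hγ => ?_⟩
  obtain ⟨ι, hι, hup⟩ := exists_finalSegment (n := m) (n' := m + 0) (Nat.le_add_right m 0)
  have hmem : rename ι (∏ i : Fin m, (X (toLex (i, i)) : MvPolynomial (MatIdx m) ℂ)) ∈
      orbitClosure (powFormLex ℂ (m + 0) m) := by
    rw [map_prod]
    simp only [rename_X]
    exact prod_X_mem_orbitClosure_powFormLex hm (Nat.le_add_right m 0) _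
  exact hc₀ m 0 hm (by rw [Nat.add_zero]; exact hwin) ι hι hup χ
    (finrank_ne_zero_extend_of_rename_mem_orbitClosure hι hup (prod_X_isHomogeneous _)
      (prod_X_ne_zero _) (by omega) hmem χ hγ)

/-- **`PowGenDegreeQP ⇒ ChowGenQP`** (the idea card's "decisive consequence", K2 form): the route's
crux K2 already forces quasi-polynomial generation of `A(Ch_m(ℂ^{m²}))`
(`sliceGen_of_powGenDegreeQP` then `chowGenQP_of_sliceGen`). [folklore] -/
theorem chowGenQP_of_powGenDegreeQP (hK2 : PowGenDegreeQP) :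
    ∀ c : ℕ, ∃ c₀ : ℕ, ∀ m : ℕ, 1 ≤ m → m ≤ 2 ^ ((Nat.log 2 m + c) ^ c) →
      ∀ χ : Weight (MatIdx m),
        Module.finrank ℂ (↥(highestWeightSpace (orbitCoordRep (∏ i : Fin m, (X (toLex (i, i)) : MvPolynomial (MatIdx m) ℂ)) m) χ) ⧸ Submodule.comap (highestWeightSpace (orbitCoordRep (∏ i : Fin m, (X (toLex (i, i)) : MvPolynomial (MatIdx m) ℂ)) m) χ).subtype (⨆ p : Weight (MatIdx m) × Weight (MatIdx m), ⨆ (_ : p.1 + p.2 = χ ∧ p.1 ≠ 0 ∧ p.2 ≠ 0), highestWeightSpace (orbitCoordRep (∏ i : Fin m, (X (toLex (i, i)) : MvPolynomial (MatIdx m) ℂ)) m) p.1 * highestWeightSpace (orbitCoordRep (∏ i : Fin m, (X (toLex (i, i)) : MvPolynomial (MatIdx m) ℂ)) m) p.2)) ≠ 0 →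
          -(Weight.size χ) ≤ (m : ℤ) * 2 ^ ((Nat.log 2 m + c₀) ^ c₀) :=
  chowGenQP_of_sliceGen (sliceGen_of_powGenDegreeQP hK2)

/-- **Late Chow generators prove K1.**  If, for every `c` and cofinally in `m`, the covariant algebra
of `Ch_m(ℂ^{m²}) = Δ(x₁₁⋯x_mm)` has a generator type `χ` of degree `-|χ| > m · 2^((log₂ m + c)^c)`,
then so does that of `Δ(per_m)` at the SAME weight — the route's crux K1 = `PerGenDegreeSuperQP`
(stmt-ValiantsHypothesis-11654), by the generator-obstruction principle along
`x₁₁⋯x_mm ∈ Δ(per_m)`. [folklore] -/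
theorem perGenDegreeSuperQP_of_chowLate
    (hC : ∀ c m₀ : ℕ, ∃ m : ℕ, m₀ ≤ m ∧ ∃ χ : Weight (MatIdx m),
      Module.finrank ℂ (↥(highestWeightSpace (orbitCoordRep (∏ i : Fin m, (X (toLex (i, i)) : MvPolynomial (MatIdx m) ℂ)) m) χ) ⧸ Submodule.comap (highestWeightSpace (orbitCoordRep (∏ i : Fin m, (X (toLex (i, i)) : MvPolynomial (MatIdx m) ℂ)) m) χ).subtype (⨆ p : Weight (MatIdx m) × Weight (MatIdx m), ⨆ (_ : p.1 + p.2 = χ ∧ p.1 ≠ 0 ∧ p.2 ≠ 0), highestWeightSpace (orbitCoordRep (∏ i : Fin m, (X (toLex (i, i)) : MvPolynomial (MatIdx m) ℂ)) m) p.1 * highestWeightSpace (orbitCoordRep (∏ i : Fin m, (X (toLex (i, i)) : MvPolynomial (MatIdx m) ℂ)) m) p.2)) ≠ 0 ∧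
        (m : ℤ) * 2 ^ ((Nat.log 2 m + c) ^ c) < -(Weight.size χ)) :
    PerGenDegreeSuperQP := by
  intro c m₀
  obtain ⟨m, hm, χ, hγ, hlt⟩ := hC c (max m₀ 1)
  refine ⟨m, le_trans (le_max_left _ _) hm, χ, ?_, hlt⟩
  have h1m : 1 ≤ m := le_trans (le_max_right _ _) hm
  exact finrank_ne_zero_of_mem_orbitClosure (by omega) (prod_X_diag_mem_orbitClosure_perPoly m) χ hγ

/-- **Late Chow generators refute `stub_sliceGen`.**  Under the same hypothesis the registered
`stub_sliceGen` (conclusion verbatim, negated) fails: at `c = 1` the window contains `n = m`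
(`m < 2^(log₂ m + 1)`), and `chowGenQP_of_sliceGen` would bound the late generator. [folklore] -/
theorem not_sliceGen_of_chowLate
    (hC : ∀ c m₀ : ℕ, ∃ m : ℕ, m₀ ≤ m ∧ ∃ χ : Weight (MatIdx m),
      Module.finrank ℂ (↥(highestWeightSpace (orbitCoordRep (∏ i : Fin m, (X (toLex (i, i)) : MvPolynomial (MatIdx m) ℂ)) m) χ) ⧸ Submodule.comap (highestWeightSpace (orbitCoordRep (∏ i : Fin m, (X (toLex (i, i)) : MvPolynomial (MatIdx m) ℂ)) m) χ).subtype (⨆ p : Weight (MatIdx m) × Weight (MatIdx m), ⨆ (_ : p.1 + p.2 = χ ∧ p.1 ≠ 0 ∧ p.2 ≠ 0), highestWeightSpace (orbitCoordRep (∏ i : Fin m, (X (toLex (i, i)) : MvPolynomial (MatIdx m) ℂ)) m) p.1 * highestWeightSpace (orbitCoordRep (∏ i : Fin m, (X (toLex (i, i)) : MvPolynomial (MatIdx m) ℂ)) m) p.2)) ≠ 0 ∧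
        (m : ℤ) * 2 ^ ((Nat.log 2 m + c) ^ c) < -(Weight.size χ)) :
    ¬ (∀ c : ℕ, ∃ c₀ : ℕ, ∀ m e : ℕ, 1 ≤ m → m + e ≤ 2 ^ ((Nat.log 2 m + c) ^ c) →
      ∀ ι : MatIdx m → MatIdx (m + e), StrictMono ι → IsUpperSet (Set.range ι) →
        ∀ χ : Weight (MatIdx m),
          Module.finrank ℂ (↥(highestWeightSpace (orbitCoordRep (powFormLex ℂ (m + e) m) m) (Function.extend ι χ 0)) ⧸ Submodule.comap (highestWeightSpace (orbitCoordRep (powFormLex ℂ (m + e) m) m) (Function.extend ι χ 0)).subtype (⨆ p : Weight (MatIdx (m + e)) × Weight (MatIdx (m + e)), ⨆ (_ : p.1 + p.2 = (Function.extend ι χ 0) ∧ p.1 ≠ 0 ∧ p.2 ≠ 0), highestWeightSpace (orbitCoordRep (powFormLex ℂ (m + e) m) m) p.1 * highestWeightSpace (orbitCoordRep (powFormLex ℂ (m + e) m) m) p.2)) ≠ 0 →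
            -(Weight.size χ) ≤ (m : ℤ) * 2 ^ ((Nat.log 2 m + c₀) ^ c₀)) := by
  intro hS
  obtain ⟨c₀, hc₀⟩ := chowGenQP_of_sliceGen hS 1
  obtain ⟨m, hm, χ, hγ, hlt⟩ := hC c₀ 1
  have hwin : m ≤ 2 ^ ((Nat.log 2 m + 1) ^ 1) := by
    rw [pow_one]
    exact (Nat.lt_pow_succ_log_self one_lt_two m).le
  exact absurd (hc₀ m hm hwin χ hγ) (not_le.mpr hlt)

/-- **Late Chow generators refute K2** (`PowGenDegreeQP`, stmt-ValiantsHypothesis-11655), through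
`sliceGen_of_powGenDegreeQP`. [folklore] -/
theorem not_powGenDegreeQP_of_chowLate
    (hC : ∀ c m₀ : ℕ, ∃ m : ℕ, m₀ ≤ m ∧ ∃ χ : Weight (MatIdx m),
      Module.finrank ℂ (↥(highestWeightSpace (orbitCoordRep (∏ i : Fin m, (X (toLex (i, i)) : MvPolynomial (MatIdx m) ℂ)) m) χ) ⧸ Submodule.comap (highestWeightSpace (orbitCoordRep (∏ i : Fin m, (X (toLex (i, i)) : MvPolynomial (MatIdx m) ℂ)) m) χ).subtype (⨆ p : Weight (MatIdx m) × Weight (MatIdx m), ⨆ (_ : p.1 + p.2 = χ ∧ p.1 ≠ 0 ∧ p.2 ≠ 0), highestWeightSpace (orbitCoordRep (∏ i : Fin m, (X (toLex (i, i)) : MvPolynomial (MatIdx m) ℂ)) m) p.1 * highestWeightSpace (orbitCoordRep (∏ i : Fin m, (X (toLex (i, i)) : MvPolynomial (MatIdx m) ℂ)) m) p.2)) ≠ 0 ∧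
        (m : ℤ) * 2 ^ ((Nat.log 2 m + c) ^ c) < -(Weight.size χ)) :
    ¬ PowGenDegreeQP :=
  fun hK2 => not_sliceGen_of_chowLate hC (sliceGen_of_powGenDegreeQP hK2)

/-- **The Chow dichotomy** (line card `slice-overflow`, "that single computation decides which side
of the route survives"): late generators of the covariant algebra of `Ch_m(ℂ^{m²})` give
`K1 ∧ ¬K2` — the permanent side of the overflow engine proved, its trace side dead. [folklore] -/
theorem chowLate_dichotomy
    (hC : ∀ c m₀ : ℕ, ∃ m : ℕ, m₀ ≤ m ∧ ∃ χ : Weight (MatIdx m),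
      Module.finrank ℂ (↥(highestWeightSpace (orbitCoordRep (∏ i : Fin m, (X (toLex (i, i)) : MvPolynomial (MatIdx m) ℂ)) m) χ) ⧸ Submodule.comap (highestWeightSpace (orbitCoordRep (∏ i : Fin m, (X (toLex (i, i)) : MvPolynomial (MatIdx m) ℂ)) m) χ).subtype (⨆ p : Weight (MatIdx m) × Weight (MatIdx m), ⨆ (_ : p.1 + p.2 = χ ∧ p.1 ≠ 0 ∧ p.2 ≠ 0), highestWeightSpace (orbitCoordRep (∏ i : Fin m, (X (toLex (i, i)) : MvPolynomial (MatIdx m) ℂ)) m) p.1 * highestWeightSpace (orbitCoordRep (∏ i : Fin m, (X (toLex (i, i)) : MvPolynomial (MatIdx m) ℂ)) m) p.2)) ≠ 0 ∧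
        (m : ℤ) * 2 ^ ((Nat.log 2 m + c) ^ c) < -(Weight.size χ)) :
    PerGenDegreeSuperQP ∧ ¬ PowGenDegreeQP :=
  ⟨perGenDegreeSuperQP_of_chowLate hC, not_powGenDegreeQP_of_chowLate hC⟩

end Dichotomy

end

end Summit.ValiantsHypothesis.ValiantsHypothesis.Theorems.GeneratorObstructions.ChowDichotomy
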